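import Literature.MathematicalPhysics.QuantumFieldTheory.Balaban1983to89.B11Prop3Model
import Mathlib.Analysis.Complex.Schwarz
import Mathlib.Analysis.Calculus.FDeriv.Analytic
import HarnessLib

/-!
# Route `UnitScaleTilt`, crux K1 «MinimiserStabilityRegPr» (stmt-QuantumFields-19200), route (α), DEPMAP node (AVG-SYM) (OWNER RULING g25-№3 §3(c)), sub-row
# (AVG-SYM-72∕an): THE CAUCHY DEVICE — `B11Prop3Model.Inputs` ((44) quadratic bound, analyticity, (72) derivative bound) FROM ANALYTICITY AND ONE SUP BOUND

Cell `ym3-torus`, width seat `ym-ust-20520-w2` (g2).  THEOREMS ONLY (0 `def`, 0 `sorry`); `--supports stmt-QuantumFields-19200`, count-neutral; lattice-free.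
YM₃ on T³ is a ladder rung (R3), not the Clay problem; nothing here claims the crux, the stub or the gap.

WHY.  The chart supplier of record for CHART-112 is `B11Prop3Model` at the SYMMETRIC remainder `Ct := CmapSym F n K U₀` of the route's constraint map
(RULING g25-№3 §3(b)); its hypothesis structure `B11Prop3Model.Inputs Ct hop C₂ C₃ B₀ c₄` asks, besides `‖hop X‖ ≤ B₀‖X‖` ((46)), for (44) `‖Ct Y‖ ≤ C₂‖Y‖²`,
for `ContDiffOn ℂ 1 Ct` and for (72) `‖fderiv ℂ Ct Y‖ ≤ C₃‖Y‖` on the ball `‖Y‖ < 2c₄` — irreducibly ℂ-analytic data (the model differentiates the fixed point,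
(70)–(73)).  [Balaban1985Averaging] proves (135)∕(157) for its averages «by the Cauchy formula» from analyticity and a sup bound; this file types that device
ONCE, for an arbitrary map of complex Banach spaces, so that node (AVG-SYM) owes exactly two facts about the complexified symmetric descent: analyticity on a
complex sup-ball of `k`-independent radius `R`, and one `k`-uniform sup bound `M` there.

WHAT IS PROVED (ns `…Theorems.Prop7AnalyticRemainderInputs`; `𝒴`, `𝒳` complex normed spaces, `𝒳` complete; `Ct : 𝒴 → 𝒳`; `0 < R`; hypotheses
`AnalyticOnNhd ℂ Ct (ball 0 R)` (or mere `DifferentiableOn` where that suffices), `∀ Y ∈ ball 0 R, ‖Ct Y‖ ≤ M`, `Ct 0 = 0`, `fderiv ℂ Ct 0 = 0`).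
* §1 `norm_fderiv_le_of_bound` — `‖fderiv ℂ Ct Y‖ ≤ 4M∕R` for `‖Y‖ < R∕2` (Schwarz lemma `Complex.dist_le_div_mul_dist_of_mapsTo_ball` on the ball of radius `R∕2`
  about `Y`, then `HasFDerivAt.le_of_lip'`).
* §2 ★ `norm_fderiv_le_mul_norm` — (72): `‖fderiv ℂ Ct Y‖ ≤ (8M∕R²)·‖Y‖` for `‖Y‖ < R∕2` (Schwarz lemma for the analytic map `Y ↦ fderiv ℂ Ct Y`, which vanishes at `0`
  and is bounded by §1).
* §3 ★ `norm_le_mul_sq` — (44): `‖Ct Y‖ ≤ (8M∕R²)·‖Y‖²` for `‖Y‖ < R∕2` (mean value inequality along the segment with §2); `contDiffOn_halfBall`.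
* §4 ★★ `inputs_of_analyticOnNhd_of_bound` — **`B11Prop3Model.Inputs Ct hop (8M∕R²) (8M∕R²) B₀ (R∕4)`** from the four hypotheses and `‖hop X‖ ≤ B₀‖X‖`.
HONEST SCOPE.  Elementary complex analysis in Banach spaces ([folklore]; the print's «Cauchy formula» route to [Balaban1985Averaging] (135), (157)); the constants
`8M∕R²` are not optimised (Schwarz of order two along lines gives `M∕R²`).  Nothing about the symmetric average itself is proved here: its complexification,
analyticity and `k`-uniform bound are the located content of node (AVG-SYM).

References: T. Bałaban, CMP 98 (1985) 17–51 [Balaban1985Averaging] (Prop. 4 (134)–(135) p.38, Prop. 5 (156)–(157) p.42, «Cauchy formula» p.37);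
CMP 102 (1985) 277–309 [Balaban1985Variational] ((44) p.285, (72) p.289).
-/

noncomputable section

open Metric Set Filter Topology

namespace Summit.QuantumFields.YangMills.Theorems.Prop7AnalyticRemainderInputs

open Literature.MathematicalPhysics.QuantumFieldTheory.Balaban1983to89

variable {𝒴 𝒳 : Type*} [NormedAddCommGroup 𝒴] [NormedSpace ℂ 𝒴] [NormedAddCommGroup 𝒳] [NormedSpace ℂ 𝒳]

/-! ## §1 The Cauchy bound on the derivative from a sup bound -/

/-- **CAUCHY BOUND**: a map `ℂ`-differentiable on `ball 0 R` and bounded by `M` there has `‖fderiv ℂ Ct Y‖ ≤ 4M∕R` at every `Y` with `‖Y‖ < R∕2`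
(Schwarz lemma on the ball of radius `R∕2` about `Y`, where `Ct` stays within `2M` of `Ct Y`). [folklore] -/
theorem norm_fderiv_le_of_bound {Ct : 𝒴 → 𝒳} {R M : ℝ} (hR : 0 < R)
    (hdiff : DifferentiableOn ℂ Ct (ball (0 : 𝒴) R)) (hbd : ∀ Y ∈ ball (0 : 𝒴) R, ‖Ct Y‖ ≤ M)
    {Y : 𝒴} (hY : ‖Y‖ < R / 2) : ‖fderiv ℂ Ct Y‖ ≤ 4 * M / R := by
  have hM : 0 ≤ M := (norm_nonneg _).trans (hbd 0 (mem_ball_self hR))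
  have hsub : ball Y (R / 2) ⊆ ball (0 : 𝒴) R := by
    intro Z hZ
    rw [mem_ball, dist_eq_norm] at hZ
    rw [mem_ball_zero_iff]
    calc ‖Z‖ = ‖(Z - Y) + Y‖ := by rw [sub_add_cancel]
      _ ≤ ‖Z - Y‖ + ‖Y‖ := norm_add_le _ _
      _ < R / 2 + R / 2 := add_lt_add hZ hY
      _ = R := by ring
  have hYR : Y ∈ ball (0 : 𝒴) R := hsub (mem_ball_self (by linarith))
  have hdiffY : DifferentiableOn ℂ Ct (ball Y (R / 2)) := hdiff.mono hsub
  have hmaps : MapsTo Ct (ball Y (R / 2)) (closedBall (Ct Y) (2 * M)) := by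
    intro Z hZ
    rw [mem_closedBall, dist_eq_norm]
    calc ‖Ct Z - Ct Y‖ ≤ ‖Ct Z‖ + ‖Ct Y‖ := norm_sub_le _ _
      _ ≤ M + M := add_le_add (hbd Z (hsub hZ)) (hbd Y hYR)
      _ = 2 * M := by ring
  -- the derivative exists at `Y` (interior point of the ball of differentiability)
  have hopen : ball (0 : 𝒴) R ∈ 𝓝 Y := isOpen_ball.mem_nhds hYR
  have hderiv : HasFDerivAt Ct (fderiv ℂ Ct Y) Y := ((hdiff Y hYR).differentiableAt hopen).hasFDerivAt
  refine hderiv.le_of_lip' (by positivity) ?_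
  have hnhds : ball Y (R / 2) ∈ 𝓝 Y := isOpen_ball.mem_nhds (mem_ball_self (by linarith))
  filter_upwards [hnhds] with Z hZ
  have hS := Complex.dist_le_div_mul_dist_of_mapsTo_ball hdiffY hmaps hZ
  rw [dist_eq_norm, dist_eq_norm] at hS
  calc ‖Ct Z - Ct Y‖ ≤ 2 * M / (R / 2) * ‖Z - Y‖ := hS
    _ = 4 * M / R * ‖Z - Y‖ := by
        congr 1
        field_simp
        ring

/-! ## §2 (72): the derivative of the remainder is `O(‖Y‖)` -/

/-- ★ **(72) FROM ANALYTICITY AND A SUP BOUND**: if moreover `Ct` is analytic on the ball and `fderiv ℂ Ct 0 = 0`, then `‖fderiv ℂ Ct Y‖ ≤ (8M∕R²)·‖Y‖`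
for `‖Y‖ < R∕2` — the Schwarz lemma for the analytic, `0`-at-`0`, `4M∕R`-bounded map `Y ↦ fderiv ℂ Ct Y` on `ball 0 (R∕2)`.
[cite: Balaban1985Averaging, Prop. 5 (157) p.42] -/
theorem norm_fderiv_le_mul_norm [CompleteSpace 𝒳] {Ct : 𝒴 → 𝒳} {R M : ℝ} (hR : 0 < R)
    (han : AnalyticOnNhd ℂ Ct (ball (0 : 𝒴) R)) (hbd : ∀ Y ∈ ball (0 : 𝒴) R, ‖Ct Y‖ ≤ M) (h1 : fderiv ℂ Ct 0 = 0)
    {Y : 𝒴} (hY : ‖Y‖ < R / 2) : ‖fderiv ℂ Ct Y‖ ≤ 8 * M / R ^ 2 * ‖Y‖ := by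
  have hM : 0 ≤ M := (norm_nonneg _).trans (hbd 0 (mem_ball_self hR))
  have hdiff : DifferentiableOn ℂ Ct (ball (0 : 𝒴) R) := han.differentiableOn
  -- the derivative map is differentiable on the half ball
  have hF : DifferentiableOn ℂ (fderiv ℂ Ct) (ball (0 : 𝒴) (R / 2)) := by
    intro Z hZ
    have hZR : Z ∈ ball (0 : 𝒴) R := by
      rw [mem_ball_zero_iff] at hZ ⊢; linarith
    exact (han Z hZR).fderiv.differentiableAt.differentiableWithinAt
  have hmaps : MapsTo (fderiv ℂ Ct) (ball (0 : 𝒴) (R / 2)) (closedBall (fderiv ℂ Ct 0) (4 * M / R)) := by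
    intro Z hZ
    rw [mem_closedBall, dist_eq_norm, h1, sub_zero]
    exact norm_fderiv_le_of_bound hR hdiff hbd (mem_ball_zero_iff.1 hZ)
  have hYb : Y ∈ ball (0 : 𝒴) (R / 2) := mem_ball_zero_iff.2 hY
  have hS := Complex.dist_le_div_mul_dist_of_mapsTo_ball hF hmaps hYb
  rw [dist_eq_norm, dist_eq_norm, h1, sub_zero, sub_zero] at hS
  calc ‖fderiv ℂ Ct Y‖ ≤ 4 * M / R / (R / 2) * ‖Y‖ := hS
    _ = 8 * M / R ^ 2 * ‖Y‖ := by
        congr 1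
        field_simp
        ring

/-! ## §3 (44): the remainder is `O(‖Y‖²)`; analyticity gives `C¹` -/

/-- ★ **(44) FROM ANALYTICITY AND A SUP BOUND**: with `Ct 0 = 0` as well, `‖Ct Y‖ ≤ (8M∕R²)·‖Y‖²` for `‖Y‖ < R∕2` (mean value inequality on the closed
ball of radius `‖Y‖`, where §2 bounds the derivative by `(8M∕R²)‖Y‖`). [cite: Balaban1985Averaging, Prop. 4 (135) p.38] -/
theorem norm_le_mul_sq [CompleteSpace 𝒳] {Ct : 𝒴 → 𝒳} {R M : ℝ} (hR : 0 < R)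
    (han : AnalyticOnNhd ℂ Ct (ball (0 : 𝒴) R)) (hbd : ∀ Y ∈ ball (0 : 𝒴) R, ‖Ct Y‖ ≤ M) (h0 : Ct 0 = 0) (h1 : fderiv ℂ Ct 0 = 0)
    {Y : 𝒴} (hY : ‖Y‖ < R / 2) : ‖Ct Y‖ ≤ 8 * M / R ^ 2 * ‖Y‖ ^ 2 := by
  have hdiff : DifferentiableOn ℂ Ct (ball (0 : 𝒴) R) := han.differentiableOn
  have hs : Convex ℝ (closedBall (0 : 𝒴) ‖Y‖) := convex_closedBall _ _
  have hmemR : ∀ Z ∈ closedBall (0 : 𝒴) ‖Y‖, Z ∈ ball (0 : 𝒴) R := by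
    intro Z hZ
    rw [mem_closedBall_zero_iff] at hZ
    rw [mem_ball_zero_iff]
    linarith
  have hdiffAt : ∀ Z ∈ closedBall (0 : 𝒴) ‖Y‖, DifferentiableAt ℂ Ct Z := fun Z hZ =>
    (hdiff Z (hmemR Z hZ)).differentiableAt (isOpen_ball.mem_nhds (hmemR Z hZ))
  have hbound : ∀ Z ∈ closedBall (0 : 𝒴) ‖Y‖, ‖fderiv ℂ Ct Z‖ ≤ 8 * M / R ^ 2 * ‖Y‖ := by
    intro Z hZ
    have hM : 0 ≤ M := (norm_nonneg _).trans (hbd 0 (mem_ball_self hR))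
    rw [mem_closedBall_zero_iff] at hZ
    calc ‖fderiv ℂ Ct Z‖ ≤ 8 * M / R ^ 2 * ‖Z‖ := norm_fderiv_le_mul_norm hR han hbd h1 (lt_of_le_of_lt hZ hY)
      _ ≤ 8 * M / R ^ 2 * ‖Y‖ := mul_le_mul_of_nonneg_left hZ (by positivity)
  have hMV := hs.norm_image_sub_le_of_norm_fderiv_le hdiffAt hbound (mem_closedBall_self (norm_nonneg Y))
    (mem_closedBall_zero_iff.2 le_rfl)
  rw [h0, sub_zero, sub_zero] at hMV
  calc ‖Ct Y‖ ≤ 8 * M / R ^ 2 * ‖Y‖ * ‖Y‖ := hMV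
    _ = 8 * M / R ^ 2 * ‖Y‖ ^ 2 := by ring

/-- An analytic map on the ball is `C¹` on every concentric sub-ball written as `{Y | ‖Y‖ < r}`. [folklore] -/
theorem contDiffOn_of_analyticOnNhd {Ct : 𝒴 → 𝒳} {R r : ℝ} (hr : r ≤ R) (han : AnalyticOnNhd ℂ Ct (ball (0 : 𝒴) R)) :
    ContDiffOn ℂ 1 Ct {Y : 𝒴 | ‖Y‖ < r} := by
  have hset : {Y : 𝒴 | ‖Y‖ < r} = ball (0 : 𝒴) r := by
    ext Y; simp
  rw [hset]
  exact (han.mono (ball_subset_ball hr)).contDiffOn isOpen_ball.uniqueDiffOn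

/-! ## §4 ★★ The `Inputs` of `B11Prop3Model` from analyticity and one sup bound -/

/-- ★★ **THE THREE REMAINDER FIELDS OF `B11Prop3Model.Inputs` FROM ANALYTICITY AND ONE SUP BOUND.**  For a map `Ct : 𝒴 → 𝒳` of complex Banach spaces,
analytic on `ball 0 R`, bounded by `M` there, with `Ct 0 = 0` and `fderiv ℂ Ct 0 = 0`, and a linear `hop` with `‖hop X‖ ≤ B₀‖X‖`:
`B11Prop3Model.Inputs Ct hop (8M∕R²) (8M∕R²) B₀ (R∕4)` — (44) with `C₂ = 8M∕R²`, `ContDiffOn ℂ 1` and (72) with `C₃ = 8M∕R²` on the ball `‖Y‖ < 2·(R∕4)`.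
The print's route («by the Cauchy formula») to [Balaban1985Averaging] (135)∕(157), typed once and consumer-agnostic.
[cite: Balaban1985Averaging, Prop. 4 (135) p.38, Prop. 5 (157) p.42; Balaban1985Variational, (44) p.285, (72) p.289] -/
theorem inputs_of_analyticOnNhd_of_bound [CompleteSpace 𝒳] {Ct : 𝒴 → 𝒳} {hop : 𝒳 →ₗ[ℂ] 𝒴} {R M B₀ : ℝ} (hR : 0 < R)
    (han : AnalyticOnNhd ℂ Ct (ball (0 : 𝒴) R)) (hbd : ∀ Y ∈ ball (0 : 𝒴) R, ‖Ct Y‖ ≤ M) (h0 : Ct 0 = 0) (h1 : fderiv ℂ Ct 0 = 0)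
    (hH : ∀ X, ‖hop X‖ ≤ B₀ * ‖X‖) :
    B11Prop3Model.Inputs Ct hop (8 * M / R ^ 2) (8 * M / R ^ 2) B₀ (R / 4) where
  norm_H := hH
  quad := fun Y hY => norm_le_mul_sq hR han hbd h0 h1 (by linarith)
  contDiff := by
    have h := contDiffOn_of_analyticOnNhd (r := 2 * (R / 4)) (by linarith) han
    exact h
  deriv_le := fun Y hY => norm_fderiv_le_mul_norm hR han hbd h1 (by linarith)

/-! ## §5 ★★ The remainder of a map beyond its linearisation: `Inputs` from analyticity and a sup bound of the MAP
(appended 2026-08-28: for a MAP `Q` analytic on `ball 0 R` with oscillation `‖Q Y − Q 0‖ ≤ M₀`, the remainder `Y ↦ Q Y − Q 0 − fderiv ℂ Q 0 Y` inhabits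
`Inputs … hop (40M₀∕R²) (40M₀∕R²) B₀ (R∕4)` — the two vanishing conditions of §4 are automatic) -/

/-- ★★ **THE REMAINDER BEYOND THE LINEARISATION.**  For a map `Q : 𝒴 → 𝒳` of complex Banach spaces analytic on `ball 0 R` with `‖Q Y − Q 0‖ ≤ M₀` there,
its nonlinear remainder `Y ↦ Q Y − Q 0 − (fderiv ℂ Q 0) Y` (written as this explicit term; no definition) and any linear `hop` with `‖hop X‖ ≤ B₀‖X‖` inhabit
`B11Prop3Model.Inputs (fun Y => Q Y − Q 0 − fderiv ℂ Q 0 Y) hop (40M₀∕R²) (40M₀∕R²) B₀ (R∕4)`: the remainder is analytic, vanishes to second order at `0`, and is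
bounded by `5M₀` on the ball (`‖fderiv ℂ Q 0‖ ≤ 4M₀∕R`, §1).  For the route: node (AVG-SYM)'s three `Inputs` letters at the symmetric remainder follow from
ANALYTICITY of the complexified symmetric descent on a complex sup-ball of `k`-independent radius and ONE `k`-uniform bound of its oscillation there.
[cite: Balaban1985Averaging, Prop. 4 (134)–(135) p.38, Prop. 5 (157) p.42; Balaban1985Variational, (44) p.285, (72) p.289] -/
theorem inputs_linRemainder_of_analyticOnNhd_of_bound [CompleteSpace 𝒳] {Q : 𝒴 → 𝒳} {hop : 𝒳 →ₗ[ℂ] 𝒴} {R M₀ B₀ : ℝ} (hR : 0 < R)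
    (han : AnalyticOnNhd ℂ Q (ball (0 : 𝒴) R)) (hbd : ∀ Y ∈ ball (0 : 𝒴) R, ‖Q Y - Q 0‖ ≤ M₀) (hH : ∀ X, ‖hop X‖ ≤ B₀ * ‖X‖) :
    B11Prop3Model.Inputs (fun Y => Q Y - Q 0 - fderiv ℂ Q 0 Y) hop (40 * M₀ / R ^ 2) (40 * M₀ / R ^ 2) B₀ (R / 4) := by
  have hM₀ : 0 ≤ M₀ := (norm_nonneg _).trans (hbd 0 (mem_ball_self hR))
  -- the oscillation `Y ↦ Q Y − Q 0` and the Cauchy bound on the linearisation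
  have hanQ' : AnalyticOnNhd ℂ (fun Y => Q Y - Q 0) (ball (0 : 𝒴) R) := han.sub analyticOnNhd_const
  have hL : ‖fderiv ℂ Q 0‖ ≤ 4 * M₀ / R := by
    have h := norm_fderiv_le_of_bound (Ct := fun Y => Q Y - Q 0) hR hanQ'.differentiableOn hbd (Y := 0) (by rw [norm_zero]; linarith)
    rwa [fderiv_sub_const] at h
  -- the remainder: analytic, bounded by `5M₀`, vanishing to second order at `0`
  have hanC : AnalyticOnNhd ℂ (fun Y => Q Y - Q 0 - fderiv ℂ Q 0 Y) (ball (0 : 𝒴) R) :=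
    hanQ'.sub ((fderiv ℂ Q 0).analyticOnNhd _)
  have hbdC : ∀ Y ∈ ball (0 : 𝒴) R, ‖Q Y - Q 0 - fderiv ℂ Q 0 Y‖ ≤ 5 * M₀ := by
    intro Y hY
    have hYR : ‖Y‖ < R := mem_ball_zero_iff.1 hY
    calc ‖Q Y - Q 0 - fderiv ℂ Q 0 Y‖ ≤ ‖Q Y - Q 0‖ + ‖fderiv ℂ Q 0 Y‖ := norm_sub_le _ _
      _ ≤ M₀ + ‖fderiv ℂ Q 0‖ * ‖Y‖ := add_le_add (hbd Y hY) (ContinuousLinearMap.le_opNorm _ _)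
      _ ≤ M₀ + 4 * M₀ / R * R := by
          refine add_le_add le_rfl (mul_le_mul hL hYR.le (norm_nonneg _) (by positivity))
      _ = 5 * M₀ := by field_simp; ring
  have h0 : (fun Y => Q Y - Q 0 - fderiv ℂ Q 0 Y) 0 = 0 := by simp
  have h1 : fderiv ℂ (fun Y => Q Y - Q 0 - fderiv ℂ Q 0 Y) 0 = 0 := by
    have hQ : HasFDerivAt Q (fderiv ℂ Q 0) 0 := ((han 0 (mem_ball_self hR)).differentiableAt).hasFDerivAt
    have h : HasFDerivAt (fun Y => Q Y - Q 0 - fderiv ℂ Q 0 Y) (fderiv ℂ Q 0 - fderiv ℂ Q 0) 0 :=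
      (hQ.sub_const (Q 0)).sub (fderiv ℂ Q 0).hasFDerivAt
    rw [h.fderiv, sub_self]
  have h := inputs_of_analyticOnNhd_of_bound hR hanC hbdC h0 h1 hH
  have hc : 8 * (5 * M₀) / R ^ 2 = 40 * M₀ / R ^ 2 := by ring
  rw [hc] at h
  exact h

end Summit.QuantumFields.YangMills.Theorems.Prop7AnalyticRemainderInputs

end
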